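import Mathlib
import Literature.Probability.LatticeModels.LatticeGraph
import HarnessLib

/-!
# Crux `PositiveSolutionAsymptotics` (stmt-CriticalPhenomena-4496), stub H2: modulation of the Green profile

THEOREM-ONLY file (no definitions, no named facts), `--supports stmt-CriticalPhenomena-4496`.
`stub_greenModulation` is stub H2 of the registered skeleton of crux
`…Theses.InverseSquareTelemetry.PositiveSolutionAsymptotics`. It is PURE REAL ANALYSIS on `ℤ³`:
for every `G : ℤ³ → ℝ` with `|G(x) - a₀/|x|| ≤ K/|x|³` off the origin (`a₀ > 0`, `K ≥ 0`), the
modulation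

  `Φ_G(z) := 6 G(z) + 2 Σᵢ zᵢ (G(z + eᵢ) - G(z - eᵢ))`

(which is, up to the factor `γ`, the lattice Laplacian of `G · (β + γ|·|²)` off the origin) satisfies
`a₀/|z| ≤ Φ_G(z) ≤ 3 a₀/|z|` for `|z| ≥ r₃ := 30 + 110 K/a₀`; informally `Φ_G(z) = 2a₀/|z| + O(|z|⁻²)`.

Proof. Write `r = |z|`, `t = zᵢ` (`|t| ≤ r`), `p = |z + eᵢ| = √(r² + 2t + 1)`, `q = |z - eᵢ| = √(r² - 2t + 1)`,
so `p, q ∈ [r - 1, r + 1]`. The main term is the exact identity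
`t · (a₀/p - a₀/q) = -4 a₀ t² / (p q (p + q))` (from `q² - p² = -4t`), and `p q (p + q) ∈ [2(r-1)³, 2(r+1)³]`;
summing `Σ tᵢ² = r²` gives `2 Σᵢ zᵢ · (main) ∈ [-4a₀r²/(r-1)³, -4a₀r²/(r+1)³] = -4a₀/r + O(a₀/r²)`. The error
terms are `≤ K/(r-1)³` each, multiplied by `|zᵢ| ≤ r`, and `|6 G(z) - 6a₀/r| ≤ 6K/r³`. The elementary
rational bounds `r²/(r+1)³ ≥ 1/r - 3/r²`, `r²/(r-1)³ ≤ 1/r + 7/r²` (`r ≥ 10`), `r/(r-1)³ ≤ 8/r²` (`r ≥ 2`)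
then give `Φ_G(z) = 2a₀/r ± (28 a₀ + 102 K)/r²`, which lies in `[a₀/r, 3a₀/r]` once `r ≥ 30 + 110 K/a₀`.
-/
noncomputable section

namespace Summit.CriticalPhenomena.Ising3DConformalLimit.Theorems.PositiveSolutionAsymptotics

open Literature.Probability.LatticeModels Finset

/-! ### Elementary rational bounds in `r` -/

/-- `a/r - 3a/r² ≤ a r²/(r+1)³` for `a ≥ 0`, `r > 0`: after clearing denominators this is
`0 ≤ a (6r² + 8r + 3)`. [folklore] -/
theorem greenMod_rat₁ {a r : ℝ} (ha : 0 ≤ a) (hr : 0 < r) :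
    a / r - 3 * (a / r ^ 2) ≤ a * r ^ 2 / (r + 1) ^ 3 := by
  have h1 : a / r - 3 * (a / r ^ 2) = a * (r - 3) / r ^ 2 := by
    field_simp
  rw [h1, div_le_div_iff₀ (by positivity) (by positivity)]
  nlinarith [mul_nonneg ha (by positivity : (0 : ℝ) ≤ 6 * r ^ 2 + 8 * r + 3)]

/-- `a r²/(r-1)³ ≤ a/r + 7a/r²` for `a ≥ 0`, `r ≥ 10`: after clearing denominators this is
`0 ≤ a (4r³ - 18r² + 20r - 7)`. [folklore] -/
theorem greenMod_rat₂ {a r : ℝ} (ha : 0 ≤ a) (hr : 10 ≤ r) :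
    a * r ^ 2 / (r - 1) ^ 3 ≤ a / r + 7 * (a / r ^ 2) := by
  have hr0 : 0 < r := by linarith
  have hr1 : 0 < r - 1 := by linarith
  have h1 : a / r + 7 * (a / r ^ 2) = a * (r + 7) / r ^ 2 := by
    field_simp
  rw [h1, div_le_div_iff₀ (pow_pos hr1 3) (by positivity)]
  have h2 : 0 ≤ (r - 10) * r ^ 2 := mul_nonneg (by linarith) (sq_nonneg r)
  have h3 : 0 ≤ (r - 10) * r := mul_nonneg (by linarith) hr0.le
  have h4 : (0 : ℝ) ≤ 4 * r ^ 3 - 18 * r ^ 2 + 20 * r - 7 := by nlinarith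
  nlinarith [mul_nonneg ha h4]

/-- `r · K/(r-1)³ ≤ 8 K/r²` for `K ≥ 0`, `r ≥ 2` (since `r ≤ 2(r-1)`, `r³ ≤ 8(r-1)³`). [folklore] -/
theorem greenMod_rat₃ {K r : ℝ} (hK : 0 ≤ K) (hr : 2 ≤ r) :
    r * (K / (r - 1) ^ 3) ≤ 8 * (K / r ^ 2) := by
  have hr0 : 0 < r := by linarith
  have hr1 : 0 < r - 1 := by linarith
  have hcube : r ^ 3 ≤ (2 * (r - 1)) ^ 3 := pow_le_pow_left₀ hr0.le (by linarith) 3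
  rw [← mul_div_assoc, ← mul_div_assoc, div_le_div_iff₀ (pow_pos hr1 3) (by positivity)]
  have h1 : r * K * r ^ 2 = K * r ^ 3 := by ring
  have h2 : 8 * K * (r - 1) ^ 3 = K * (2 * (r - 1)) ^ 3 := by ring
  rw [h1, h2]
  exact mul_le_mul_of_nonneg_left hcube hK

/-- `K/r³ ≤ K/r²` for `K ≥ 0`, `r ≥ 1`. [folklore] -/
theorem greenMod_rat₄ {K r : ℝ} (hK : 0 ≤ K) (hr : 1 ≤ r) : K / r ^ 3 ≤ K / r ^ 2 :=
  div_le_div_of_nonneg_left hK (by positivity) (pow_le_pow_right₀ hr (by norm_num))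

/-- The choice of `r₃`: if `30 + 110 K/a ≤ r` (`a > 0`, `K ≥ 0`) then `28 a/r² + 102 K/r² ≤ a/r`. [folklore] -/
theorem greenMod_rat₅ {a K r : ℝ} (ha : 0 < a) (hK : 0 ≤ K) (hr : 30 + 110 * K / a ≤ r) :
    28 * (a / r ^ 2) + 102 * (K / r ^ 2) ≤ a / r := by
  have hKa : 0 ≤ 110 * K / a := by positivity
  have hr0 : 0 < r := by linarith
  have h1 : 30 * a + 110 * K ≤ a * r := by
    have h := mul_le_mul_of_nonneg_left hr ha.le
    have e : a * (30 + 110 * K / a) = 30 * a + 110 * K := by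
      field_simp
    linarith [h, e]
  have h2 : 28 * (a / r ^ 2) + 102 * (K / r ^ 2) = (28 * a + 102 * K) / r ^ 2 := by ring
  rw [h2, div_le_div_iff₀ (by positivity) hr0]
  nlinarith [mul_nonneg hr0.le (by linarith : 0 ≤ a * r - 28 * a - 102 * K)]

/-! ### One coordinate direction: the pure real estimate -/

/-- **One direction, real form.** For `a₀ > 0`, `K ≥ 0`, `r ≥ 2`, `|t| ≤ r` and reals `gp, gm` with
`|gp - a₀/√(r²+2t+1)| ≤ K/√(r²+2t+1)³`, `|gm - a₀/√(r²-2t+1)| ≤ K/√(r²-2t+1)³` (think `t = zᵢ`,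
`gp = G(z+eᵢ)`, `gm = G(z-eᵢ)`):
`-2a₀t²/(r-1)³ - 2rK/(r-1)³ ≤ t (gp - gm) ≤ -2a₀t²/(r+1)³ + 2rK/(r-1)³`.
The main term is the identity `t (a₀/p - a₀/q) = -4a₀t²/(pq(p+q))` with `p q (p+q) ∈ [2(r-1)³, 2(r+1)³]`.
[folklore] -/
theorem greenMod_coord_real {a₀ K r t gp gm : ℝ} (ha : 0 < a₀) (hK : 0 ≤ K) (hr : 2 ≤ r)
    (ht : |t| ≤ r)
    (hp : |gp - a₀ / Real.sqrt (r ^ 2 + 2 * t + 1)| ≤ K / Real.sqrt (r ^ 2 + 2 * t + 1) ^ 3)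
    (hm : |gm - a₀ / Real.sqrt (r ^ 2 - 2 * t + 1)| ≤ K / Real.sqrt (r ^ 2 - 2 * t + 1) ^ 3) :
    t * (gp - gm) ≤ -(2 * (a₀ / (r + 1) ^ 3 * t ^ 2)) + 2 * (r * (K / (r - 1) ^ 3)) ∧
      -(2 * (a₀ / (r - 1) ^ 3 * t ^ 2)) - 2 * (r * (K / (r - 1) ^ 3)) ≤ t * (gp - gm) := by
  obtain ⟨ht1, ht2⟩ := abs_le.1 ht
  have hr1 : 1 ≤ r - 1 := by linarith
  have hA : (r - 1) ^ 2 ≤ r ^ 2 + 2 * t + 1 := by nlinarith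
  have hA' : r ^ 2 + 2 * t + 1 ≤ (r + 1) ^ 2 := by nlinarith
  have hB : (r - 1) ^ 2 ≤ r ^ 2 - 2 * t + 1 := by nlinarith
  have hB' : r ^ 2 - 2 * t + 1 ≤ (r + 1) ^ 2 := by nlinarith
  -- the two distances `p = |z + eᵢ|`, `q = |z - eᵢ|`
  have hp_lo : r - 1 ≤ Real.sqrt (r ^ 2 + 2 * t + 1) := Real.le_sqrt_of_sq_le hA
  have hp_hi : Real.sqrt (r ^ 2 + 2 * t + 1) ≤ r + 1 :=
    Real.sqrt_le_iff.2 ⟨by linarith, hA'⟩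
  have hp2 : Real.sqrt (r ^ 2 + 2 * t + 1) ^ 2 = r ^ 2 + 2 * t + 1 := Real.sq_sqrt (by nlinarith)
  have hq_lo : r - 1 ≤ Real.sqrt (r ^ 2 - 2 * t + 1) := Real.le_sqrt_of_sq_le hB
  have hq_hi : Real.sqrt (r ^ 2 - 2 * t + 1) ≤ r + 1 :=
    Real.sqrt_le_iff.2 ⟨by linarith, hB'⟩
  have hq2 : Real.sqrt (r ^ 2 - 2 * t + 1) ^ 2 = r ^ 2 - 2 * t + 1 := Real.sq_sqrt (by nlinarith)
  generalize Real.sqrt (r ^ 2 + 2 * t + 1) = p at hp hp_lo hp_hi hp2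
  generalize Real.sqrt (r ^ 2 - 2 * t + 1) = q at hm hq_lo hq_hi hq2
  have hp0 : 0 < p := by linarith
  have hq0 : 0 < q := by linarith
  have hP0 : 0 < p * q * (p + q) := by positivity
  -- main term: the exact identity
  have key : t * (a₀ / p - a₀ / q) = -(4 * a₀ * t ^ 2 / (p * q * (p + q))) := by
    rw [← neg_div, eq_div_iff hP0.ne']
    have e : t * (a₀ / p - a₀ / q) * (p * q * (p + q)) =
        t * ((a₀ / p * p) * q - (a₀ / q * q) * p) * (p + q) := by ring
    rw [e, div_mul_cancel₀ a₀ hp0.ne', div_mul_cancel₀ a₀ hq0.ne']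
    have e2 : t * (a₀ * q - a₀ * p) * (p + q) = t * a₀ * (q ^ 2 - p ^ 2) := by ring
    rw [e2, hp2, hq2]
    ring
  -- main term: bounds on the denominator `p q (p + q)`
  have hpq_lo : (r - 1) * (r - 1) ≤ p * q := mul_le_mul hp_lo hq_lo (by linarith) (by linarith)
  have hpq_hi : p * q ≤ (r + 1) * (r + 1) := mul_le_mul hp_hi hq_hi hq0.le (by linarith)
  have hPlo : 2 * (r - 1) ^ 3 ≤ p * q * (p + q) := by
    have h := mul_le_mul hpq_lo (add_le_add hp_lo hq_lo) (by linarith) (mul_nonneg hp0.le hq0.le)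
    calc 2 * (r - 1) ^ 3 = (r - 1) * (r - 1) * ((r - 1) + (r - 1)) := by ring
      _ ≤ p * q * (p + q) := h
  have hPhi : p * q * (p + q) ≤ 2 * (r + 1) ^ 3 := by
    have h := mul_le_mul hpq_hi (add_le_add hp_hi hq_hi) (by linarith) (by positivity)
    calc p * q * (p + q) ≤ (r + 1) * (r + 1) * ((r + 1) + (r + 1)) := h
      _ = 2 * (r + 1) ^ 3 := by ring
  have hnum : 0 ≤ 4 * a₀ * t ^ 2 := by positivity
  have h2lo : 0 < 2 * (r - 1) ^ 3 := mul_pos two_pos (pow_pos (by linarith) 3)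
  have hM_hi : t * (a₀ / p - a₀ / q) ≤ -(2 * (a₀ / (r + 1) ^ 3 * t ^ 2)) := by
    rw [key, neg_le_neg_iff]
    calc 2 * (a₀ / (r + 1) ^ 3 * t ^ 2) = 4 * a₀ * t ^ 2 / (2 * (r + 1) ^ 3) := by
          field_simp
          ring
      _ ≤ 4 * a₀ * t ^ 2 / (p * q * (p + q)) := div_le_div_of_nonneg_left hnum hP0 hPhi
  have hM_lo : -(2 * (a₀ / (r - 1) ^ 3 * t ^ 2)) ≤ t * (a₀ / p - a₀ / q) := by
    rw [key, neg_le_neg_iff]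
    calc 4 * a₀ * t ^ 2 / (p * q * (p + q)) ≤ 4 * a₀ * t ^ 2 / (2 * (r - 1) ^ 3) :=
          div_le_div_of_nonneg_left hnum h2lo hPlo
      _ = 2 * (a₀ / (r - 1) ^ 3 * t ^ 2) := by
          field_simp
          ring
  -- error terms
  have hr1' : 0 < r - 1 := by linarith
  have hp3 : K / p ^ 3 ≤ K / (r - 1) ^ 3 :=
    div_le_div_of_nonneg_left hK (pow_pos hr1' 3) (pow_le_pow_left₀ hr1'.le hp_lo 3)
  have hq3 : K / q ^ 3 ≤ K / (r - 1) ^ 3 :=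
    div_le_div_of_nonneg_left hK (pow_pos hr1' 3) (pow_le_pow_left₀ hr1'.le hq_lo 3)
  have hεp : |t * (gp - a₀ / p)| ≤ r * (K / (r - 1) ^ 3) := by
    rw [abs_mul]
    exact mul_le_mul ht (hp.trans hp3) (abs_nonneg _) (by linarith)
  have hεm : |t * (gm - a₀ / q)| ≤ r * (K / (r - 1) ^ 3) := by
    rw [abs_mul]
    exact mul_le_mul ht (hm.trans hq3) (abs_nonneg _) (by linarith)
  obtain ⟨hεp1, hεp2⟩ := abs_le.1 hεp
  obtain ⟨hεm1, hεm2⟩ := abs_le.1 hεm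
  have hsplit : t * (gp - gm) = t * (a₀ / p - a₀ / q) + t * (gp - a₀ / p) - t * (gm - a₀ / q) := by
    ring
  constructor
  · linarith
  · linarith

/-! ### One coordinate direction on the lattice -/

/-- `|z + eᵢ|² = |z|² + 2 zᵢ + 1` on `ℤ³`. [folklore] -/
theorem greenMod_sumSq_add_single (z : Site 3) (i : Fin 3) :
    ∑ j, (((z + Pi.single i 1 : Site 3) j : ℤ) : ℝ) ^ 2 =
      ∑ j, ((z j : ℤ) : ℝ) ^ 2 + 2 * ((z i : ℤ) : ℝ) + 1 := by
  fin_cases i <;> simp [Fin.sum_univ_three] <;> ring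

/-- `|z - eᵢ|² = |z|² - 2 zᵢ + 1` on `ℤ³`. [folklore] -/
theorem greenMod_sumSq_sub_single (z : Site 3) (i : Fin 3) :
    ∑ j, (((z - Pi.single i 1 : Site 3) j : ℤ) : ℝ) ^ 2 =
      ∑ j, ((z j : ℤ) : ℝ) ^ 2 - 2 * ((z i : ℤ) : ℝ) + 1 := by
  fin_cases i <;> simp [Fin.sum_univ_three] <;> ring

/-- A site of `ℤ³` with `|x|² > 0` is not the origin. [folklore] -/
theorem greenMod_ne_zero_of_sumSq_pos (x : Site 3) (h : 0 < ∑ j, ((x j : ℤ) : ℝ) ^ 2) : x ≠ 0 := by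
  rintro rfl
  simp at h

/-- **One direction, lattice form.** Under `|G(x) - a₀/|x|| ≤ K/|x|³` off the origin, for `|z| = r ≥ 2`
and each coordinate `i`:
`-2a₀zᵢ²/(r-1)³ - 2rK/(r-1)³ ≤ zᵢ (G(z+eᵢ) - G(z-eᵢ)) ≤ -2a₀zᵢ²/(r+1)³ + 2rK/(r-1)³`
(`greenMod_coord_real` with `t = zᵢ`, `|z ± eᵢ|² = r² ± 2zᵢ + 1`). [folklore] -/
theorem greenMod_coord {G : Site 3 → ℝ} {a₀ K r : ℝ} (ha : 0 < a₀) (hK : 0 ≤ K)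
    (hG : ∀ x : Site 3, x ≠ 0 → |G x - a₀ / Real.sqrt (∑ i, ((x i : ℤ) : ℝ) ^ 2)| ≤
      K / Real.sqrt (∑ i, ((x i : ℤ) : ℝ) ^ 2) ^ 3)
    (z : Site 3) (hr : Real.sqrt (∑ j, ((z j : ℤ) : ℝ) ^ 2) = r) (h2 : 2 ≤ r) (i : Fin 3) :
    ((z i : ℤ) : ℝ) * (G (z + Pi.single i 1) - G (z - Pi.single i 1)) ≤
        -(2 * (a₀ / (r + 1) ^ 3 * ((z i : ℤ) : ℝ) ^ 2)) + 2 * (r * (K / (r - 1) ^ 3)) ∧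
      -(2 * (a₀ / (r - 1) ^ 3 * ((z i : ℤ) : ℝ) ^ 2)) - 2 * (r * (K / (r - 1) ^ 3)) ≤
        ((z i : ℤ) : ℝ) * (G (z + Pi.single i 1) - G (z - Pi.single i 1)) := by
  have hs0 : 0 ≤ ∑ j, ((z j : ℤ) : ℝ) ^ 2 := Finset.sum_nonneg fun j _ => sq_nonneg _
  have hsr : ∑ j, ((z j : ℤ) : ℝ) ^ 2 = r ^ 2 := by rw [← hr, Real.sq_sqrt hs0]
  have hsq : ((z i : ℤ) : ℝ) ^ 2 ≤ ∑ j, ((z j : ℤ) : ℝ) ^ 2 :=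
    Finset.single_le_sum (f := fun j => ((z j : ℤ) : ℝ) ^ 2) (fun j _ => sq_nonneg _)
      (Finset.mem_univ i)
  have ht : |((z i : ℤ) : ℝ)| ≤ r := hr ▸ Real.abs_le_sqrt hsq
  obtain ⟨ht1, ht2⟩ := abs_le.1 ht
  have hA : ∑ j, (((z + Pi.single i 1 : Site 3) j : ℤ) : ℝ) ^ 2 = r ^ 2 + 2 * ((z i : ℤ) : ℝ) + 1 := by
    rw [greenMod_sumSq_add_single, hsr]
  have hB : ∑ j, (((z - Pi.single i 1 : Site 3) j : ℤ) : ℝ) ^ 2 = r ^ 2 - 2 * ((z i : ℤ) : ℝ) + 1 := by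
    rw [greenMod_sumSq_sub_single, hsr]
  have hne_p : (z + Pi.single i 1 : Site 3) ≠ 0 :=
    greenMod_ne_zero_of_sumSq_pos _ (by rw [hA]; nlinarith)
  have hne_m : (z - Pi.single i 1 : Site 3) ≠ 0 :=
    greenMod_ne_zero_of_sumSq_pos _ (by rw [hB]; nlinarith)
  have hp := hG _ hne_p
  have hm := hG _ hne_m
  rw [hA] at hp
  rw [hB] at hm
  exact greenMod_coord_real ha hK h2 ht hp hm

/-! ### The stub -/

/-- **H2 (modulation of the Green profile).** For every `G : ℤ³ → ℝ` with
`|G(x) - a₀/|x|| ≤ K/|x|³` off the origin (`a₀ > 0`, `K ≥ 0`) there is `r₃ ≥ 1` (namely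
`r₃ = 30 + 110 K/a₀`) such that for `|z| ≥ r₃`,
`a₀/|z| ≤ 6 G(z) + 2 Σᵢ zᵢ (G(z+eᵢ) - G(z-eᵢ)) ≤ 3 a₀/|z|`:
the central term is `6a₀/r + O(K/r³)`, the gradient term is `-4a₀/r + O((a₀ + K)/r²)`
(`greenMod_coord` summed over the three directions with `Σ zᵢ² = r²`), and the elementary bounds
`greenMod_rat₁…₅` close the estimate. [folklore] -/
theorem stub_greenModulation :
    ∀ (G : Literature.Probability.LatticeModels.Site 3 → ℝ) (a₀ K : ℝ), 0 < a₀ → 0 ≤ K →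
      (∀ x : Literature.Probability.LatticeModels.Site 3, x ≠ 0 → |G x - a₀ / Real.sqrt (∑ i, ((x i : ℤ) : ℝ) ^ 2)| ≤ K / Real.sqrt (∑ i, ((x i : ℤ) : ℝ) ^ 2) ^ 3) →
      ∃ r₃ : ℝ, 1 ≤ r₃ ∧ ∀ z : Literature.Probability.LatticeModels.Site 3, r₃ ≤ Real.sqrt (∑ i, ((z i : ℤ) : ℝ) ^ 2) →
        a₀ / Real.sqrt (∑ i, ((z i : ℤ) : ℝ) ^ 2) ≤ 6 * G z + 2 * ∑ i : Fin 3, ((z i : ℤ) : ℝ) * (G (z + Pi.single i 1) - G (z - Pi.single i 1)) ∧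
        6 * G z + 2 * ∑ i : Fin 3, ((z i : ℤ) : ℝ) * (G (z + Pi.single i 1) - G (z - Pi.single i 1)) ≤ 3 * a₀ / Real.sqrt (∑ i, ((z i : ℤ) : ℝ) ^ 2) := by
  intro G a₀ K ha hK hG
  have hKa : 0 ≤ 110 * K / a₀ := by positivity
  refine ⟨30 + 110 * K / a₀, by linarith, fun z hz => ?_⟩
  have hs0 : 0 ≤ ∑ j, ((z j : ℤ) : ℝ) ^ 2 := Finset.sum_nonneg fun j _ => sq_nonneg _
  have hr30 : 30 ≤ Real.sqrt (∑ j, ((z j : ℤ) : ℝ) ^ 2) := by linarith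
  have hz0 : z ≠ 0 :=
    greenMod_ne_zero_of_sumSq_pos z (Real.sqrt_pos.1 (by linarith))
  have h0 := hG z hz0
  have hc := fun i => greenMod_coord ha hK hG z rfl (by linarith) i
  have hsr : ∑ j, ((z j : ℤ) : ℝ) ^ 2 = Real.sqrt (∑ j, ((z j : ℤ) : ℝ) ^ 2) ^ 2 :=
    (Real.sq_sqrt hs0).symm
  generalize Real.sqrt (∑ j, ((z j : ℤ) : ℝ) ^ 2) = r at hz hr30 h0 hc hsr ⊢
  have hr0 : 0 < r := by linarith
  obtain ⟨h01, h02⟩ := abs_le.1 h0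
  obtain ⟨hu0, hl0⟩ := hc 0
  obtain ⟨hu1, hl1⟩ := hc 1
  obtain ⟨hu2, hl2⟩ := hc 2
  have h3 : r ^ 2 = ((z 0 : ℤ) : ℝ) ^ 2 + ((z 1 : ℤ) : ℝ) ^ 2 + ((z 2 : ℤ) : ℝ) ^ 2 := by
    rw [← hsr, Fin.sum_univ_three]
  have Ip : a₀ / (r + 1) ^ 3 * ((z 0 : ℤ) : ℝ) ^ 2 + a₀ / (r + 1) ^ 3 * ((z 1 : ℤ) : ℝ) ^ 2 +
      a₀ / (r + 1) ^ 3 * ((z 2 : ℤ) : ℝ) ^ 2 = a₀ * r ^ 2 / (r + 1) ^ 3 := by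
    rw [h3]
    ring
  have Im : a₀ / (r - 1) ^ 3 * ((z 0 : ℤ) : ℝ) ^ 2 + a₀ / (r - 1) ^ 3 * ((z 1 : ℤ) : ℝ) ^ 2 +
      a₀ / (r - 1) ^ 3 * ((z 2 : ℤ) : ℝ) ^ 2 = a₀ * r ^ 2 / (r - 1) ^ 3 := by
    rw [h3]
    ring
  have R1 := greenMod_rat₁ ha.le hr0
  have R2 := greenMod_rat₂ ha.le (by linarith : (10 : ℝ) ≤ r)
  have R3 := greenMod_rat₃ hK (by linarith : (2 : ℝ) ≤ r)
  have R4 := greenMod_rat₄ hK (by linarith : (1 : ℝ) ≤ r)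
  have R5 := greenMod_rat₅ ha hK hz
  have hW2 : 0 ≤ a₀ / r ^ 2 := by positivity
  have h3a : 3 * a₀ / r = 3 * (a₀ / r) := mul_div_assoc _ _ _
  rw [Fin.sum_univ_three]
  constructor
  · linarith
  · linarith

end Summit.CriticalPhenomena.Ising3DConformalLimit.Theorems.PositiveSolutionAsymptotics
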